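import Literature.NumberTheory.Sieve.PolymathBoundedGaps
import Literature.NumberTheory.Sieve.ParityWave0MaynardProofs
import Literature.NumberTheory.Sieve.ParityWave0MaynardTaoProofs
import Literature.NumberTheory.Sieve.MaynardK105
import Literature.NumberTheory.Sieve.VaughanMeanValue
import HarnessLib

/-!
# Zhang's bounded gaps theorem: Theorem 1 as printed, and its reduction layer

`Literature.NumberTheory.Sieve.ParityWave0` records the *consequence* clause of Zhang's Theorem 1
(**parity.S13**, `Literature.NumberTheory.Sieve.frequently_nth_prime_succ_lt_add_zhang`: `p_{n+1} < p_n + 7·10⁷` for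
infinitely many `n`; Y. Zhang, *Bounded gaps between primes*, Ann. of Math. 179 (2014), 1121–1174,
Theorem 1: "… Consequently, `liminf (p_{n+1} − p_n) < 7 × 10⁷`") as a named fact.  Its printed proof
is a theory: Zhang's Theorem 2 (a Bombieri–Vinogradov type estimate for smooth moduli of level
`x^{1/2 + 1/584}`, with the residues tied to the tuple — Polymath 8a, p. 3; cf. parity.S29
`Literature.NumberTheory.Sieve.MPZ`/`mpz_of_lt`) fed into the Goldston–Pintz–Yıldırım sieve with `k₀ = 3.5·10⁶`; none of
the analytic inputs (Bombieri–Vinogradov, Siegel–Walfisz, the large sieve, the exponential-sum bounds)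
is in Mathlib.  This file vendors

* the **main clause of Theorem 1 as printed** — "Suppose that `H` is admissible with
  `k₀ ≥ 3.5 × 10⁶`.  Then there are infinitely many positive integers `n` such that the `k₀`-tuple
  `{n + h₁, …, n + h_{k₀}}` contains at least two primes" — i.e. `DHL[k₀, 2]` for `k₀ ≥ 3 500 000`
  in the notation of Polymath 8b (Claim 3.1 = `Literature.NumberTheory.Sieve.WeakDicksonHardyLittlewood`; their Theorem 1.2
  "Zhang's theorem" records the consequence `H₁ ≤ 7·10⁷` only), as the named fact
  `Literature.NumberTheory.Sieve.weakDHL_two_zhang` (restated verbatim in Ram Murty's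
  exposition; Granville, Bull. AMS 52 (2015), §1.3 "Zhang's main theorem … `k = 3 500 000`");
* the **numerical input** of Zhang's passage "Consequently …": `π(7·10⁷) − π(3.5·10⁶) > 3.5·10⁶`
  (Zhang, deduction after Theorem 1, from Dusart's bounds; Ram Murty p. 9), as the named fact
  `Literature.NumberTheory.Sieve.primeCounting_zhang` (true values `π(7·10⁷) = 4 118 064`, `π(3.5·10⁶) = 250 150`,
  checked by a sieve outside Lean; a kernel evaluation at this height is out of reach and explicit
  `π(x)` bounds are not in Mathlib);
* and PROVES everything between them and parity.S13:
  - `Literature.NumberTheory.Sieve.IsAdmissibleTuple.subset`, `Literature.NumberTheory.Sieve.WeakDicksonHardyLittlewood.of_le` (`DHL[k, j]` is monotone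
    in `k`, whence Zhang's "`k₀ ≥ 3.5·10⁶`" is the single statement `DHL[3 500 000, 2]`,
    `weakDHL_two_zhang_iff`);
  - `Literature.NumberTheory.Sieve.isAdmissibleTuple_image_natCast_of_prime`: `k` primes each `> k` form an admissible
    `k`-tuple (Zhang's recipe "`k₀` primes in `[3.5·10⁶, 7·10⁷]`"; Granville 2015, footnote to
    Corollary 1.1: "the first `k` primes `> k`");
  - `Literature.NumberTheory.Sieve.WeakDicksonHardyLittlewood.frequently_nth_prime_succ_lt_add` (strict-inequality form of
    "`DHL[k, 2]` implies `H₁ ≤ H(k)`", Polymath 8b p. 8, from the accepted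
    `WeakDicksonHardyLittlewood.frequently_nth_prime_add_le`), `…_le_add_sub` (tuples in `[L, U]`),
    `….exists_frequently_nth_prime_succ_le_add` (Granville 2015, Corollary 1.1: `DHL[k, 2]` for one
    `k` gives bounded gaps);
  - `Literature.NumberTheory.Sieve.frequently_nth_prime_succ_le_add_of_weakDHL_of_primeCounting`
    (`DHL[k, 2] ∧ π(k) + k ≤ π(D) ⟹ p_{m+1} ≤ p_m + (D − (k+1))` infinitely often) and
    `Literature.NumberTheory.Sieve.frequently_nth_prime_succ_lt_add_zhang_of_weakDHL`: **Zhang's one-sentence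
    deduction** `weakDHL_two_zhang ∧ primeCounting_zhang ⟹ parity.S13 (Zhang)`.
* The **Maynard route, now with two leaves left**: Maynard, Ann. of Math. 181 (2015), §4, proof of the
  unconditional theorem (`liminf (p_{n+1} − p_n) ≤ 600`; Thm 1.3 of the arXiv text, "Thm 1.2" in
  `ParityWave0`) — Bombieri–Vinogradov (`Literature.NumberTheory.Sieve.BombieriVinogradovStatement`), `M₁₀₅ > 4` (Prop. 4.3(2), now
  PROVED in the tree: `Literature.NumberTheory.Sieve.exists_four_lt_maynardFunctional_holds`, `MaynardK105`) and Prop. 4.2 with the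
  conclusion of Thm 3.1 (`Literature.NumberTheory.Sieve.frequently_card_primes_ge_of_maynardFunctional`, via the accepted
  `Literature.NumberTheory.Sieve.weakDHL_of_maynardFunctional_gt`) give `DHL[105, 2]`
  (`Literature.NumberTheory.Sieve.weakDHL_105_two_of_bombieriVinogradovStatement`, two hypotheses), hence Zhang's main clause
  `weakDHL_two_zhang` by monotonicity (`weakDHL_two_zhang_of_bombieriVinogradovStatement`); and, through the
  accepted assembly of Maynard's Theorem 1.3 with Engelsma's `105`-tuple
  (`Parity.frequently_nth_prime_succ_le_add_maynard_of_bombieriVinogradovStatement`, `ParityWave0MaynardProofs`),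
  Zhang's statement itself (`frequently_nth_prime_succ_lt_add_zhang_of_bombieriVinogradovStatement`,
  `…_of_bombieri_vinogradov`).  The trivial edges from Maynard's `≤ 600` and Polymath 8b's `≤ 246` facts
  are `…_of_maynard`, `…_of_polymath`.

So the discharge `frequently_nth_prime_succ_lt_add_zhang_holds` awaits EXACTLY parity.S28
`siegel_walfisz` (Bombieri–Vinogradov being reduced to it by `bombieri_vinogradov_of_siegelWalfisz` of
`VaughanMeanValue`, where Vaughan's mean value theorem is proved) and Maynard's Proposition 4.2
`frequently_card_primes_ge_of_maynardFunctional` (the multidimensional Selberg sieve, Maynard §§5–6):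
`frequently_nth_prime_succ_lt_add_zhang_of_siegelWalfisz`.  Zhang's own route would instead need
(`weakDHL_two_zhang`, `primeCounting_zhang`), i.e. his Theorem 2 and Dusart-strength bounds for `π(x)`.

## Design notes

* `DHL[k, j]` is the accepted `Literature.WeakDicksonHardyLittlewood k j` (`PolymathBoundedGaps`): tuples
  `H : Finset ℤ` with `Literature.NumberTheory.Sieve.IsAdmissibleTuple`, `n : ℕ → ∞` along `atTop`, primes among the `n + h`
  counted as in `Literature.NumberTheory.Sieve.frequently_card_primes_ge_of_maynardFunctional`.  Zhang's "infinitely many positive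
  integers `n`" is the same statement (only `n → +∞` can contribute).
* Tuples used to extract gaps are taken in `ℕ` (`T : Finset ℕ`, `H = T.image Nat.cast`), which is
  what Zhang's construction (a set of primes) produces, and avoids `Int.toNat` bookkeeping.
* Nothing here duplicates Mathlib or the tree: `Nat.nth`, `Nat.count`, `Nat.primesLE`,
  `Nat.primeCounting` are used, not redefined; `DHL`, its antitonicity in `j`, the passage to consecutive
  primes and Maynard's theorem in `DHL` form come from `PolymathBoundedGaps`; Engelsma's tuple and the
  assembly of Maynard's Theorem 1.3 from `ParityWave0MaynardProofs`; "no member `≡ 0 (mod p)` for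
  `p ≤ #H` ⟹ admissible" from `ParityWave0MaynardTaoProofs`; `M₁₀₅ > 4` from `MaynardK105`;
  `siegel_walfisz → bombieri_vinogradov` from `VaughanMeanValue`.

## References

* Y. Zhang, *Bounded gaps between primes*, Ann. of Math. (2) 179 (2014), 1121–1174,
  doi:10.4007/annals.2014.179.3.7: Theorem 1 (both clauses and the deduction of the second from the
  first), Theorem 2. [cite: ZhangAnnals2014] (paywalled here, acquisition requested; the statements are
  cross-checked against the expositions below, Ram Murty's restating Theorem 1 verbatim).
* M. Ram Murty, *The twin prime problem and generalisations (après Yitang Zhang)*, Asia Pacific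
  Mathematics Newsletter 3 (2013) no. 4, 7–14, p. 9: Zhang's Theorem 1 and the deduction of
  `liminf (p_{n+1} − p_n) < 7·10⁷` from `k₀` primes in `[3.5·10⁶, 7·10⁷]` and
  `π(7·10⁷) − π(3.5·10⁶) > 3.5·10⁶`. [cite: RamMurty2013Zhang]
* D. H. J. Polymath, *Variants of the Selberg sieve, and bounded intervals containing many primes*,
  Res. Math. Sci. 1:12 (2014), arXiv:1407.4897: Theorem 1.2 ("Zhang's theorem", p. 3), Claim 3.1
  (`DHL[k, j]`) and the remark "`DHL[k, m+1]` implies `H_m ≤ H(k)`" (p. 8), Theorem 3.8. [cite: Polymath8b2014]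
* D. H. J. Polymath, *New equidistribution estimates of Zhang type*, Algebra Number Theory 8 (2014),
  2067–2199, arXiv:1402.0811, p. 3 (Zhang's Theorem 2: level `1/2 + 1/584`, residues the roots of
  `∏_{j ≠ i} (n + h_j − h_i)`). [cite: Polymath8a2014]
* A. Granville, *Primes in intervals of bounded length*, Bull. Amer. Math. Soc. 52 (2015), 171–222,
  arXiv:1410.8400, §1.3 ("Zhang's main theorem", `k = 3 500 000`; Corollary 1.1 and its footnote on the
  first `k` primes `> k`). [cite: Granville2015PrimesIntervals]
* R. C. Vaughan, *An elementary method in prime number theory*, Acta Arith. 37 (1980), 111–115, Theorem 3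
  (Bombieri–Vinogradov from the mean value theorem and Siegel–Walfisz). [cite: Vaughan1980]
* J. Maynard, *Small gaps between primes*, Ann. of Math. (2) 181 (2015), 383–413, arXiv:1311.4600:
  Propositions 4.2, 4.3 and the proof of Theorem 1.3 (arXiv numbering; `liminf ≤ 600`) in §4, p. 8. [cite: MaynardAnnals2015]
-/

open Filter Finset

namespace Literature.NumberTheory.Sieve

/-! ### `DHL[k, j]` is monotone in `k` -/

/-- A sub-tuple of an admissible tuple is admissible: it occupies no more residue classes modulo any
prime (immediate from the definition; used implicitly whenever `DHL[k, j]` is applied inside a larger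
admissible tuple, e.g. Zhang's "admissible with `k₀ ≥ 3.5·10⁶`"). [folklore] -/
theorem IsAdmissibleTuple.subset {H H' : Finset ℤ} (h : IsAdmissibleTuple H) (hsub : H' ⊆ H) :
    IsAdmissibleTuple H' := fun p hp =>
  (Finset.card_le_card (Finset.image_subset_image hsub)).trans_lt (h p hp)

/-- `DHL[k, j]` is monotone in `k`: an admissible `k'`-tuple with `k' ≥ k` contains an admissible
`k`-sub-tuple (`IsAdmissibleTuple.subset`), and primes in a translate of the sub-tuple are primes in the
same translate of the tuple.  This is why Zhang may state Theorem 1 for all admissible tuples with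
`k₀ ≥ 3.5·10⁶` elements (`Literature.NumberTheory.Sieve.weakDHL_two_zhang_iff`). [folklore] -/
theorem WeakDicksonHardyLittlewood.of_le {k k' j : ℕ} (h : WeakDicksonHardyLittlewood k j)
    (hk : k ≤ k') : WeakDicksonHardyLittlewood k' j := by
  intro H' hH' hk'
  obtain ⟨H, hsub, hcard⟩ := Finset.exists_subset_card_eq (s := H') (n := k) (hk.trans_eq hk'.symm)
  refine (h H (hH'.subset hsub) hcard).mono fun n hn => hn.trans ?_
  exact Finset.card_le_card (Finset.filter_subset_filter _ hsub)

/-! ### Admissible tuples of primes -/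

/-- **`k` primes exceeding `k` form an admissible `k`-tuple** (the recipe of Zhang's deduction of the
second clause of Theorem 1 — in Ram Murty's restatement: "if `p > k₀`, `ν_p(H) ≤ k₀ < p`.  If
`p < k₀` and `ν_p(H) = p`, then one of the prime elements is divisible by `p` and hence equal to `p`, a
contradiction" — and of Granville, Bull. AMS 52 (2015), §1.3, footnote to Corollary 1.1: "letting the
`aᵢ` be the first `k` primes `> k`").  For a prime `q ≤ k` no element is `≡ 0 (mod q)` (an element
`p` is a prime `> k ≥ q`, so `q ∤ p`); this is the hypothesis of the accepted
`Literature.NumberTheory.Sieve.isAdmissibleTuple_of_forall_not_dvd` (`ParityWave0MaynardTaoProofs`), which handles the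
primes `q > k` by counting. [cite: Granville2015PrimesIntervals, §1.3, footnote to Corollary 1.1] -/
theorem isAdmissibleTuple_image_natCast_of_prime {T : Finset ℕ}
    (hT : ∀ p ∈ T, p.Prime ∧ T.card < p) :
    IsAdmissibleTuple (T.image (Nat.cast : ℕ → ℤ)) := by
  refine Sieve.isAdmissibleTuple_of_forall_not_dvd _ fun q hq hqk h hh hdvd => ?_
  rw [Finset.card_image_of_injective _ Nat.cast_injective] at hqk
  obtain ⟨p, hp, rfl⟩ := Finset.mem_image.1 hh
  have hqp : q ∣ p := by exact_mod_cast hdvd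
  have h1 := (Nat.prime_dvd_prime_iff_eq hq (hT p hp).1).1 hqp
  have h2 := (hT p hp).2
  omega

/-! ### From `DHL[k, 2]` to gaps between consecutive primes -/

/-- Strict form of "`DHL[k, 2]` implies `H₁ ≤ H(k)`" (Polymath 8b, §3, remark after Claim 3.1; the
shape of Zhang's `liminf (p_{n+1} − p_n) < 7·10⁷`): if all differences of members of the admissible
`k`-tuple `H` are `< D`, then `p_{m+1} < p_m + D` for infinitely many `m`.  (If some translate of `H`
contains two primes then `H` is nonempty, so `0 < D` and the differences are `≤ D − 1`; then
`WeakDicksonHardyLittlewood.frequently_nth_prime_add_le` with `m = 1`.) [cite: Polymath8b2014, §3, remark after Claim 3.1] -/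
theorem WeakDicksonHardyLittlewood.frequently_nth_prime_succ_lt_add {k : ℕ}
    (h : WeakDicksonHardyLittlewood k 2) {H : Finset ℤ} (hH : IsAdmissibleTuple H) (hk : H.card = k)
    {D : ℕ} (hD : ∀ a ∈ H, ∀ b ∈ H, b - a < (D : ℤ)) :
    ∃ᶠ m in atTop, Nat.nth Nat.Prime (m + 1) < Nat.nth Nat.Prime m + D := by
  obtain ⟨n, hn⟩ := (h H hH hk).exists
  obtain ⟨a, ha, -⟩ := Finset.one_lt_card.1 hn
  have hD0 : 0 < D := by
    have := hD a (Finset.mem_filter.1 ha).1 a (Finset.mem_filter.1 ha).1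
    omega
  have hle := h.frequently_nth_prime_add_le (m := 1) hH hk (d := D - 1) fun a ha b hb => by
    have := hD a ha b hb
    push_cast [Nat.cast_sub hD0]
    omega
  exact hle.mono fun m hm => by omega

/-- "`DHL[k, 2]` implies `H₁ ≤ H(k)`" for a tuple of natural numbers lying in `[L, U]` (diameter
`≤ U − L`): `p_{m+1} ≤ p_m + (U − L)` for infinitely many `m` (Polymath 8b, p. 8, via the accepted
`WeakDicksonHardyLittlewood.frequently_nth_prime_add_le`). [cite: Polymath8b2014, §3, remark after Claim 3.1] -/
theorem WeakDicksonHardyLittlewood.frequently_nth_prime_succ_le_add_sub {k : ℕ}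
    (h : WeakDicksonHardyLittlewood k 2) {T : Finset ℕ}
    (hadm : IsAdmissibleTuple (T.image (Nat.cast : ℕ → ℤ))) (hcard : T.card = k) {L U : ℕ}
    (hT : ∀ t ∈ T, L ≤ t ∧ t ≤ U) :
    ∃ᶠ m in atTop, Nat.nth Nat.Prime (m + 1) ≤ Nat.nth Nat.Prime m + (U - L) := by
  refine h.frequently_nth_prime_add_le (m := 1) hadm
    (by rw [Finset.card_image_of_injective _ Nat.cast_injective, hcard]) (d := U - L)
    fun a ha b hb => ?_
  simp only [Finset.mem_image] at ha hb
  obtain ⟨s, hs, rfl⟩ := ha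
  obtain ⟨t, ht, rfl⟩ := hb
  have := hT s hs
  have := hT t ht
  omega

/-- **Bounded gaps from `DHL[k, 2]`** (Granville, Bull. AMS 52 (2015), Corollary 1.1 [Bounded gaps
between primes]: "To deduce that there are bounded gaps between primes from Zhang's Theorem we need
only show the existence of an admissible set with `k` elements … letting the `aᵢ` be the first `k`
primes `> k`"): if `DHL[k, 2]` holds for some `k`, then `p_{m+1} ≤ p_m + C` infinitely often for some
`C`.  The tuple is any `k` primes `> k` (there are infinitely many primes), admissible by
`isAdmissibleTuple_image_natCast_of_prime`. [cite: Granville2015PrimesIntervals, Corollary 1.1] -/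
theorem WeakDicksonHardyLittlewood.exists_frequently_nth_prime_succ_le_add {k : ℕ}
    (h : WeakDicksonHardyLittlewood k 2) :
    ∃ C : ℕ, ∃ᶠ m in atTop, Nat.nth Nat.Prime (m + 1) ≤ Nat.nth Nat.Prime m + C := by
  have hinf : {p : ℕ | p.Prime ∧ k < p}.Infinite :=
    Nat.frequently_atTop_iff_infinite.1
      ((Nat.frequently_atTop_iff_infinite.2 Nat.infinite_setOf_prime).and_eventually
        (eventually_gt_atTop k))
  obtain ⟨T, hTsub, hTcard⟩ := hinf.exists_subset_card_eq k
  obtain ⟨C, hC⟩ := T.bddAbove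
  have hadm : IsAdmissibleTuple (T.image (Nat.cast : ℕ → ℤ)) :=
    isAdmissibleTuple_image_natCast_of_prime fun p hp => ⟨(hTsub hp).1, hTcard ▸ (hTsub hp).2⟩
  have hT : ∀ t ∈ T, 0 ≤ t ∧ t ≤ C := fun t ht => ⟨Nat.zero_le _, hC ht⟩
  exact ⟨C, by simpa using h.frequently_nth_prime_succ_le_add_sub hadm hTcard hT⟩

end Literature.NumberTheory.Sieve

namespace Literature.NumberTheory.Sieve

/-! ### Zhang's Theorem 1: the main clause, the numerical input, and the printed deduction -/

/-- **Zhang's Theorem 1, main clause** (Y. Zhang, Ann. of Math. 179 (2014), 1121–1174, Theorem 1;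
restated verbatim in Ram Murty, Asia Pac. Math. Newsl. 3 (2013) no. 4, p. 9): "Suppose that `H` is
admissible with `k₀ ≥ 3.5 × 10⁶`.  Then there are infinitely many positive integers `n` such that the
`k₀`-tuple `{n + h₁, …, n + h_{k₀}}` contains at least two primes."  In the notation of Polymath 8b
(Claim 3.1, the notation `DHL[k, j]`; their Theorem 1.2 "Zhang's theorem" records only the consequence
`H₁ ≤ 7·10⁷`): `DHL[k₀, 2]` for every `k₀ ≥ 3 500 000` (Granville,
Bull. AMS 52 (2015), §1.3: "Zhang proved this result for … `k = 3 500 000`").  The printed proof is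
Zhang's Theorem 2 (level of distribution `1/2 + 1/584` for `x^ϖ`-smooth squarefree moduli,
`ϖ = 1/1168`, with the residues tied to the tuple; essentially the case `ϖ = δ = 1/1168` of
`MPZ[ϖ, δ]`, cf. parity.S29 `Literature.NumberTheory.Sieve.mpz_of_lt`) fed into the Goldston–Pintz–Yıldırım argument
(Zhang §§3–5, `l₀ = 180`); a named fact here.  The consequence `liminf (p_{n+1} − p_n) < 7·10⁷`
printed in the same theorem is parity.S13 (`frequently_nth_prime_succ_lt_add_zhang`), deduced below
(`frequently_nth_prime_succ_lt_add_zhang_of_weakDHL`). [cite: ZhangAnnals2014, Theorem 1 (main clause)][cite: RamMurty2013Zhang, Theorem 1][cite: Polymath8b2014, Claim 3.1 (notation only)] -/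
def weakDHL_two_zhang : Prop :=
  ∀ k : ℕ, 3500000 ≤ k → WeakDicksonHardyLittlewood k 2

/-- Zhang's "admissible with `k₀ ≥ 3.5·10⁶`" is the single statement `DHL[3 500 000, 2]`, by
monotonicity of `DHL[k, 2]` in `k` (`WeakDicksonHardyLittlewood.of_le`). [folklore] -/
theorem weakDHL_two_zhang_iff : weakDHL_two_zhang ↔ WeakDicksonHardyLittlewood 3500000 2 :=
  ⟨fun h => h _ le_rfl, fun h _ hk => h.of_le hk⟩

/-- **Zhang's numerical input** (Zhang, Ann. of Math. 179 (2014), the deduction of the second clause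
of Theorem 1 from the first; in Ram Murty's restatement, p. 9: "Zhang shows that the second assertion
follows from the first if we choose for `H` a set of `k₀ = 3.5 × 10⁶` primes lying in the interval
`[3.5 × 10⁶, 7 × 10⁷]`.  This can be done since `π(7 × 10⁷) − π(3.5 × 10⁶) > 3.5 × 10⁶` from known
explicit upper and lower bounds for `π(x)` due to Dusart"), in subtraction-free form:
`π(3.5·10⁶) + 3.5·10⁶ < π(7·10⁷)` with Mathlib's `Nat.primeCounting` (`π(x) = #{p ≤ x}`).  True values
(sieve of Eratosthenes, outside Lean): `π(7·10⁷) = 4 118 064`, `π(3.5·10⁶) = 250 150`, difference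
`3 867 914`.  A decidable closed statement, vendored as a named fact because a kernel evaluation at this
height is infeasible and explicit bounds for `π(x)` (Rosser–Schoenfeld, Dusart) are not in Mathlib.
[cite: ZhangAnnals2014, Theorem 1, deduction of the second clause][cite: RamMurty2013Zhang, p. 9] -/
def primeCounting_zhang : Prop :=
  Nat.primeCounting 3500000 + 3500000 < Nat.primeCounting (7 * 10 ^ 7)

/-- **`DHL[k, 2]` and `π(k) + k ≤ π(D)` give `p_{m+1} ≤ p_m + (D − (k + 1))` infinitely often** —
the general form of Zhang's deduction of `liminf (p_{n+1} − p_n) < 7·10⁷` (second clause of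
Theorem 1) from the first clause: the primes in `(k, D]` number `π(D) − π(k) ≥ k`, any `k` of them
form an admissible `k`-tuple (`Literature.NumberTheory.Sieve.isAdmissibleTuple_image_natCast_of_prime`) contained in
`[k + 1, D]`, and `WeakDicksonHardyLittlewood.frequently_nth_prime_succ_le_add_sub` applies.
[cite: ZhangAnnals2014, Theorem 1, deduction of the second clause][cite: RamMurty2013Zhang, p. 9] -/
theorem frequently_nth_prime_succ_le_add_of_weakDHL_of_primeCounting {k D : ℕ}
    (h : WeakDicksonHardyLittlewood k 2) (hπ : Nat.primeCounting k + k ≤ Nat.primeCounting D) :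
    ∃ᶠ m in atTop, Nat.nth Nat.Prime (m + 1) ≤ Nat.nth Nat.Prime m + (D - (k + 1)) := by
  -- the primes in `(k, D]`
  set S : Finset ℕ := (Nat.primesLE D).filter fun p => k < p with hS
  have hsub : Nat.primesLE D ⊆ S ∪ Nat.primesLE k := by
    intro p hp
    rw [Nat.mem_primesLE] at hp
    rcases lt_or_ge k p with hkp | hpk
    · exact Finset.mem_union_left _ (Finset.mem_filter.2 ⟨Nat.mem_primesLE.2 hp, hkp⟩)
    · exact Finset.mem_union_right _ (Nat.mem_primesLE.2 ⟨hpk, hp.2⟩)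
  have hScard : k ≤ S.card := by
    have h1 := (Finset.card_le_card hsub).trans (Finset.card_union_le _ _)
    rw [Nat.primesLE_card_eq_primeCounting, Nat.primesLE_card_eq_primeCounting] at h1
    omega
  obtain ⟨T, hTS, hTcard⟩ := Finset.exists_subset_card_eq hScard
  have hT : ∀ p ∈ T, p.Prime ∧ k < p ∧ p ≤ D := fun p hp => by
    have hp' := hTS hp
    simp only [hS, Finset.mem_filter, Nat.mem_primesLE] at hp'
    exact ⟨hp'.1.2, hp'.2, hp'.1.1⟩
  have hadm : IsAdmissibleTuple (T.image (Nat.cast : ℕ → ℤ)) :=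
    isAdmissibleTuple_image_natCast_of_prime fun p hp => ⟨(hT p hp).1, hTcard ▸ (hT p hp).2.1⟩
  exact h.frequently_nth_prime_succ_le_add_sub hadm hTcard fun t ht => ⟨(hT t ht).2.1, (hT t ht).2.2⟩

/-- **Zhang's deduction of `liminf (p_{n+1} − p_n) < 7·10⁷`** (Ann. of Math. 179 (2014), Theorem 1:
"Consequently, `liminf (p_{n+1} − p_n) < 7 × 10⁷`"): the main clause `weakDHL_two_zhang`
(`DHL[k₀, 2]`, `k₀ = 3.5·10⁶`) and the inequality `π(7·10⁷) − π(3.5·10⁶) > 3.5·10⁶`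
(`primeCounting_zhang`) give parity.S13 in Zhang's form, `p_{n+1} < p_n + 7·10⁷` infinitely often —
indeed `≤ p_n + 66 499 999`, a bound for the diameter of `k₀` primes in `(3.5·10⁶, 7·10⁷]`.  This is
Zhang's own route to the discharge (both inputs are named facts); the Maynard route below needs neither.
[cite: ZhangAnnals2014, Theorem 1 (second clause from the first)][cite: RamMurty2013Zhang, p. 9] -/
theorem frequently_nth_prime_succ_lt_add_zhang_of_weakDHL (h₁ : weakDHL_two_zhang)
    (h₂ : primeCounting_zhang) : frequently_nth_prime_succ_lt_add_zhang := by
  have := frequently_nth_prime_succ_le_add_of_weakDHL_of_primeCounting (h₁ _ le_rfl) h₂.le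
  refine this.mono fun m hm => ?_
  norm_num at hm ⊢
  omega

/-! ### The Maynard route: Bombieri–Vinogradov and Proposition 4.2 (with `M₁₀₅ > 4` proved) -/

/-- **`DHL[105, 2]` from Bombieri–Vinogradov and Maynard's Proposition 4.2** (Maynard, *Small gaps
between primes*, §4, proof of the unconditional theorem, arXiv:1311.4600 p. 8: "We take `k = 105`. …
By the Bombieri–Vinogradov theorem, the primes have level of distribution `θ = 1/2 − ε` for any
`ε > 0`.  Thus, if we take `ε` sufficiently small, we have `θ M₁₀₅/2 > 1`"): given
`Literature.NumberTheory.Sieve.BombieriVinogradovStatement` (`PrimesHaveLevel θ` for every `θ < 1/2`) and Prop. 4.2 / Thm 3.1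
(`frequently_card_primes_ge_of_maynardFunctional`, in `DHL` form `weakDHL_of_maynardFunctional_gt` =
Polymath 8b Thm 3.8), the PROVED Prop. 4.3(2) `M₁₀₅ > 4` (`exists_four_lt_maynardFunctional_holds`,
`MaynardK105`) supplies an admissible `F` on `R₁₀₅` with functional `M > 4`; choose `θ` with
`2/M < θ < 1/2`, so that `2·1/θ < M`, and `DHL[105, 2]` follows. [cite: MaynardAnnals2015, §4, proof of Theorem 1.3 of arXiv:1311.4600 (p. 8)] -/
theorem weakDHL_105_two_of_bombieriVinogradovStatement (hBV : BombieriVinogradovStatement)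
    (h42 : frequently_card_primes_ge_of_maynardFunctional) : WeakDicksonHardyLittlewood 105 2 := by
  obtain ⟨F, hF, h4⟩ := exists_four_lt_maynardFunctional_holds
  set M := maynardFunctional 105 F with hMdef
  have hM0 : 0 < M := by linarith
  obtain ⟨θ, hθ1, hθ2⟩ := exists_between (show 2 / M < 1 / 2 by
    rw [div_lt_iff₀ hM0]; linarith)
  have hθ0 : 0 < θ := lt_trans (div_pos two_pos hM0) hθ1
  refine weakDHL_of_maynardFunctional_gt h42 hθ0 (hBV θ hθ2) hF (m := 1) ?_
  rw [div_lt_iff₀ hM0] at hθ1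
  rw [Nat.cast_one, mul_one, div_lt_iff₀ hθ0]
  linarith [mul_comm θ M]

/-- **Zhang's Theorem 1, main clause, from Bombieri–Vinogradov and Maynard's Proposition 4.2**:
`DHL[105, 2]` (`weakDHL_105_two_of_bombieriVinogradovStatement`) and monotonicity of `DHL[k, 2]` in `k`
(`WeakDicksonHardyLittlewood.of_le`, `105 ≤ 3.5·10⁶`) give `weakDHL_two_zhang`.  Thus the named fact
for Zhang's main clause is reduced to the two leaves `BombieriVinogradovStatement` (parity.S27) and
`frequently_card_primes_ge_of_maynardFunctional` (Maynard Prop. 4.2), Maynard's route replacing Zhang's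
own (Theorem 2, the level of distribution `1/2 + 1/584` for smooth moduli).
[cite: ZhangAnnals2014, Theorem 1 (main clause)][cite: MaynardAnnals2015, §4 (k = 105 under Bombieri–Vinogradov)] -/
theorem weakDHL_two_zhang_of_bombieriVinogradovStatement (hBV : BombieriVinogradovStatement)
    (h42 : frequently_card_primes_ge_of_maynardFunctional) : weakDHL_two_zhang :=
  fun _ hk => (weakDHL_105_two_of_bombieriVinogradovStatement hBV h42).of_le
    (le_trans (by norm_num) hk)

/-- Zhang's `liminf (p_{n+1} − p_n) < 7·10⁷` from Maynard's `liminf ≤ 600` (parity.S13,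
`frequently_nth_prime_succ_le_add_maynard`; Maynard, Ann. of Math. 181 (2015), Theorem 1.3 of
arXiv:1311.4600, "Thm 1.2" in the docstring of `ParityWave0`). [cite: MaynardAnnals2015, Theorem 1.3 (liminf ≤ 600)] -/
theorem frequently_nth_prime_succ_lt_add_zhang_of_maynard
    (h : frequently_nth_prime_succ_le_add_maynard) : frequently_nth_prime_succ_lt_add_zhang :=
  h.mono fun m hm => by
    have h7 : (600 : ℕ) < 7 * 10 ^ 7 := by norm_num
    omega

/-- **Zhang's statement along the Maynard route, two leaves left**: Bombieri–Vinogradov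
(`Literature.NumberTheory.Sieve.BombieriVinogradovStatement`) and Maynard's Proposition 4.2
(`Literature.NumberTheory.Sieve.frequently_card_primes_ge_of_maynardFunctional`) imply parity.S13 in Zhang's form: by the accepted
assembly of Maynard's Theorem 1.3 (`Parity.frequently_nth_prime_succ_le_add_maynard_of_bombieriVinogradovStatement`,
`ParityWave0MaynardProofs`: Engelsma's admissible `105`-tuple of diameter `600`), fed with the PROVED
`M₁₀₅ > 4` (`exists_four_lt_maynardFunctional_holds`, `MaynardK105`), and `600 < 7·10⁷`.  This is the
DAG along which the discharge `frequently_nth_prime_succ_lt_add_zhang_holds` runs: it awaits exactly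
`bombieri_vinogradov` (parity.S27; `BombieriVinogradovReduction`: Vaughan's mean value theorem and
Siegel–Walfisz) and Maynard's Proposition 4.2 (the multidimensional sieve, Maynard §§5–6).
[cite: MaynardAnnals2015, Theorem 1.3 (liminf ≤ 600 < 7·10⁷) and its proof in §4] -/
theorem frequently_nth_prime_succ_lt_add_zhang_of_bombieriVinogradovStatement
    (hBV : BombieriVinogradovStatement) (h42 : frequently_card_primes_ge_of_maynardFunctional) :
    frequently_nth_prime_succ_lt_add_zhang :=
  frequently_nth_prime_succ_lt_add_zhang_of_maynard
    (frequently_nth_prime_succ_le_add_maynard_of_bombieriVinogradovStatement hBV h42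
      exists_four_lt_maynardFunctional_holds)

/-- The same from the Wave0 form parity.S27 `bombieri_vinogradov` (Bombieri, Mathematika 12 (1965),
Thm 4), via the accepted bridge `bombieriVinogradovStatement_of_bombieri_vinogradov`
(`ParityWave0Proofs`). [cite: MaynardAnnals2015, Theorem 1.3 and its proof in §4] -/
theorem frequently_nth_prime_succ_lt_add_zhang_of_bombieri_vinogradov (hBV : bombieri_vinogradov)
    (h42 : frequently_card_primes_ge_of_maynardFunctional) : frequently_nth_prime_succ_lt_add_zhang :=
  frequently_nth_prime_succ_lt_add_zhang_of_bombieriVinogradovStatement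
    (bombieriVinogradovStatement_of_bombieri_vinogradov hBV) h42

/-- **Zhang's statement from the Siegel–Walfisz theorem and Maynard's Proposition 4.2** — the current
frontier of the discharge: with Vaughan's mean value theorem PROVED in the tree
(`vaughan_meanValue_holds`, `VaughanMeanValue.lean`), Bombieri–Vinogradov only needs Siegel–Walfisz
(`bombieri_vinogradov_of_siegelWalfisz`; Vaughan, Acta Arith. 37 (1980), Thm 3), so parity.S13 in Zhang's
form follows from parity.S28 `siegel_walfisz` (Walfisz 1936) and
`frequently_card_primes_ge_of_maynardFunctional` (Maynard Prop. 4.2).  The discharge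
`frequently_nth_prime_succ_lt_add_zhang_holds` is this theorem applied to the two `_holds` of those facts,
once they land. [cite: MaynardAnnals2015, Theorem 1.3 and its proof in §4][cite: Vaughan1980, Theorem 3] -/
theorem frequently_nth_prime_succ_lt_add_zhang_of_siegelWalfisz (hSW : siegel_walfisz)
    (h42 : frequently_card_primes_ge_of_maynardFunctional) : frequently_nth_prime_succ_lt_add_zhang :=
  frequently_nth_prime_succ_lt_add_zhang_of_bombieri_vinogradov (bombieri_vinogradov_of_siegelWalfisz hSW) h42

/-- Zhang's `liminf (p_{n+1} − p_n) < 7·10⁷` from Polymath 8b's `liminf ≤ 246` (parity.S13,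
`frequently_nth_prime_succ_le_add_polymath`; Polymath, Res. Math. Sci. 1:12 (2014), Theorem 1.4(i)),
hence also from the three leaves of `PolymathBoundedGaps`
(`frequently_nth_prime_succ_le_add_polymath_of_bombieriVinogradovStatement`). [cite: Polymath8b2014, Theorem 1.4(i)] -/
theorem frequently_nth_prime_succ_lt_add_zhang_of_polymath
    (h : frequently_nth_prime_succ_le_add_polymath) : frequently_nth_prime_succ_lt_add_zhang :=
  h.mono fun m hm => by
    have h7 : (246 : ℕ) < 7 * 10 ^ 7 := by norm_num
    omega

end Literature.NumberTheory.Sieve
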